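import Mathlib
import HarnessLib
import Summits.HubbardSuperconductivity.HubbardSuperconductivity.Theorems.KLProgrammeKLRegimeVolumeLimitCarrierRateDoor
import Summits.HubbardSuperconductivity.HubbardSuperconductivity.Theorems.KLProgrammeKLRegimeVolumeLimitV14StubVlBound
import Summits.HubbardSuperconductivity.HubbardSuperconductivity.Theorems.KLProgrammeKLRegimeVolumeLimitSixBound
import Summits.HubbardSuperconductivity.HubbardSuperconductivity.Theses.KLProgramme

/-!
# Child `KLRegimeVolumeLimitV14` (stmt-HubbardSuperconductivity-19921) FROM THE ONE OPEN STUB: the route decl follows from the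
# same-cutoff two-volume rate of the bare carrier (cell gate-hubbard-kl, seat hubbard-kl-k3c4-p1 g5 = registrant of skeleton «cauchy» v3
# d43a8bd19247ce15; `--supports` the VolumeLimit child)

Everything the VL child needs except the engine's volume export is in the tree: `stub_vl_bound` (k3c4-p2 p495604, via (H1) p495319),
`TwoPointAssembly.stub_vl_sixBound_holds` (k3c5-p1 p495796), the doors `stub_vl_rates_of_carrierRate` (k3c5-p2 p498296) ∘
`stub_vl_twoVolumeRate_of_bareRates_V14` (k3c5-p3 p492329) and the Cauchy bridge `exists_finalTwoLegVolLimit_of_twoVolumeRate` (k3c4-p1 p475992).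
This file composes them ONCE, with the open stub as an explicit hypothesis:

* **`klRegimeVolumeLimitV14_of_carrierRate (hcar) : …Theses.KLProgramme.KLRegimeVolumeLimitV14`** — `hcar` = the REGISTERED text of
  `stub_vl_carrierRate` (skeleton v3): under the child's binder prefix, `∃ L₀ D ρ → 0` with, for `L₀ ≤ L ≤ L′` and all cutoffs `M ≥ M₀(L, L′)`,
  `‖klSelfEnergy L M β U μ 0 klE0 (nScales β+1) (ω,k) 0 − klSelfEnergy L′ M β U μ 0 klE0 (nScales β+1) (ω,k′) 0‖ ≤ ρ L + D·Σ_i |p_k i − p′_{k′} i|_𝕋`.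

So the CLOSER of 19921 is the one-liner `theorem … : …KLRegimeVolumeLimitV14 := klRegimeVolumeLimitV14_of_carrierRate stub_vl_carrierRate`
(`--workitem stmt-HubbardSuperconductivity-19921`) the minute the engine lineage lands `…Theorems.KLRegimeVolumeLimit.stub_vl_carrierRate`.
An implication, sorry-free; it does not itself close the item (its type is not the route decl).  No definitions.
-/

noncomputable section

namespace Summit.HubbardSuperconductivity.HubbardSuperconductivity.Theorems.KLRegimeVolumeLimit

set_option linter.dupNamespace false -- summit = problem name (single-conjunct summit), D-0017

open Filter Topology Finset Literature.MathematicalPhysics.QuantumLattice Literature.Probability.LatticeModels GrassmannAlgebra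
open Summit.HubbardSuperconductivity.HubbardSuperconductivity.Theorems.KLProgrammeLegKernels
open Summit.HubbardSuperconductivity.HubbardSuperconductivity.Theorems.KLRegimeSplit
open Summit.HubbardSuperconductivity.HubbardSuperconductivity.Theorems.TwoPointAssembly

/-- **THE VL CHILD FROM THE CARRIER RATE.**  If the bare last-scale self-energy has a same-cutoff two-volume rate with cross-grid torus
modulus in the KL regime (the registered stub `stub_vl_carrierRate` of skeleton «cauchy» v3, text verbatim as the hypothesis), then the route decl
`…Theses.KLProgramme.KLRegimeVolumeLimitV14 = VolumeLimitP2 klPredsV14 FinalTwoLegVolLimitEx klWindowC` holds: density and six-point rates by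
`stub_vl_rates_of_carrierRate`, six-point bound by `stub_vl_sixBound_holds`, frame and cutoff by `stub_vl_twoVolumeRate_of_bareRates_V14`, carrier bound
by `stub_vl_bound`, then the Cauchy bridge `exists_finalTwoLegVolLimit_of_twoVolumeRate` (`c₅ := min`, `U₀ := min`, thresholds by `max`). -/
theorem klRegimeVolumeLimitV14_of_carrierRate
    (hcar :
    ∀ (G : GeoConsts) (P : SplitConsts) (Q : EngConsts) (R : RenConsts), G.WF → P.WF → Q.WF → R.WF →
      ∃ c₅ : ℝ, 0 < c₅ ∧ ∀ c : ℝ, 0 < c → c ≤ c₅ → ∃ U₀ : ℝ, 0 < U₀ ∧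
        ∀ μ ∈ klWindowC, ∀ U : ℝ, 0 < U → U ≤ U₀ → ∀ β : ℝ, klBetaMin ≤ β → β ≤ Real.exp (c / U ^ 2) →
          ∀ K : TrigPolyC4v, klPredsV14.frameOK R U (nScales β) μ K →
            ∀ (Lstar : ℕ) (Mstar : ℕ → ℕ), TowerP klPredsV14 G P Q R β U μ K Lstar Mstar →
              ∃ L₀ : ℕ, ∃ D : ℝ, ∃ ρ : ℕ → ℝ, Tendsto ρ atTop (𝓝 0) ∧
                ∀ (L : ℕ) [NeZero L], L₀ ≤ L → ∀ (L' : ℕ) [NeZero L'], L ≤ L' → ∃ M₀ : ℕ, ∀ (M : ℕ) [NeZero M], M₀ ≤ M →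
                  ∀ (ω : MatsubaraIdx M) (k : TorusSite 2 L) (k' : TorusSite 2 L'),
                    ‖klSelfEnergy L M β U μ 0 klE0 (nScales β + 1) (ω, k) 0 -
                        klSelfEnergy L' M β U μ 0 klE0 (nScales β + 1) (ω, k') 0‖ ≤
                      ρ L + D * ∑ i, torusAbs (latticeMomentum L k i - latticeMomentum L' k' i)) :
    Summit.HubbardSuperconductivity.HubbardSuperconductivity.Theses.KLProgramme.KLRegimeVolumeLimitV14 := by
  -- the bare rates from the carrier rate and the six-point bound
  have hrates := stub_vl_rates_of_carrierRate hcar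
  have hbare : ∀ (G : GeoConsts) (P : SplitConsts) (Q : EngConsts) (R : RenConsts), G.WF → P.WF → Q.WF → R.WF →
      ∃ c₅ : ℝ, 0 < c₅ ∧ ∀ c : ℝ, 0 < c → c ≤ c₅ → ∃ U₀ : ℝ, 0 < U₀ ∧
        ∀ μ ∈ klWindowC, ∀ U : ℝ, 0 < U → U ≤ U₀ → ∀ β : ℝ, klBetaMin ≤ β → β ≤ Real.exp (c / U ^ 2) →
          ∀ K : TrigPolyC4v, klPredsV14.frameOK R U (nScales β) μ K →
            ∀ (Lstar : ℕ) (Mstar : ℕ → ℕ), TowerP klPredsV14 G P Q R β U μ K Lstar Mstar →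
              ∃ L₀ : ℕ, ∃ D₂ : ℝ, ∃ B : ℝ, ∃ ρ₁ : ℕ → ℝ, ∃ ρ₂ : ℕ → ℝ, Tendsto ρ₁ atTop (𝓝 0) ∧ Tendsto ρ₂ atTop (𝓝 0) ∧
                (∀ (L : ℕ) [NeZero L], L₀ ≤ L → ∀ (L' : ℕ) [NeZero L'], L ≤ L' → ‖klOccInf L β U μ - klOccInf L' β U μ‖ ≤ ρ₁ L) ∧
                (∀ (L : ℕ) [NeZero L], L₀ ≤ L → ∀ (L' : ℕ) [NeZero L'], L ≤ L' →
                  ∀ (n : ℤ) (k : TorusSite 2 L) (k' : TorusSite 2 L'),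
                    ‖klSixInf L β U μ n k - klSixInf L' β U μ n k'‖ ≤
                      ρ₂ L + D₂ * ∑ i, torusAbs (latticeMomentum L k i - latticeMomentum L' k' i)) ∧
                (∀ (L : ℕ) [NeZero L], L₀ ≤ L → ∀ (n : ℤ) (k : TorusSite 2 L), ‖klSixInf L β U μ n k‖ ≤ B) := by
    intro G P Q R hG hP hQ hR
    obtain ⟨c₁, hc₁, h₁⟩ := hrates G P Q R hG hP hQ hR
    obtain ⟨c₂, hc₂, h₂⟩ := stub_vl_sixBound_holds G P Q R hG hP hQ hR
    refine ⟨min c₁ c₂, lt_min hc₁ hc₂, fun c hc hcle => ?_⟩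
    obtain ⟨U₁, hU₁, h₁'⟩ := h₁ c hc (hcle.trans (min_le_left _ _))
    obtain ⟨U₂, hU₂, h₂'⟩ := h₂ c hc (hcle.trans (min_le_right _ _))
    refine ⟨min U₁ U₂, lt_min hU₁ hU₂, ?_⟩
    intro μ hμ U hU hUle β hβ hβle K hK Lstar Mstar hT
    obtain ⟨L₁, D₂, ρ₁, ρ₂, hρ₁, hρ₂, hocc, hsix⟩ :=
      h₁' μ hμ U hU (hUle.trans (min_le_left _ _)) β hβ hβle K hK Lstar Mstar hT
    obtain ⟨L₂, B, hB⟩ := h₂' μ hμ U hU (hUle.trans (min_le_right _ _)) β hβ hβle K hK Lstar Mstar hT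
    refine ⟨max L₁ L₂, D₂, B, ρ₁, ρ₂, hρ₁, hρ₂, ?_, ?_, ?_⟩
    · intro L _ hL L' _ hLL'
      exact hocc L (le_of_max_le_left hL) L' hLL'
    · intro L _ hL L' _ hLL' n k k'
      exact hsix L (le_of_max_le_left hL) L' hLL' n k k'
    · intro L _ hL n k
      exact hB L (le_of_max_le_right hL) n k
  -- frame and cutoff: v1's two-volume rate of the full carrier
  have htwo := TwoPointAssembly.stub_vl_twoVolumeRate_of_bareRates_V14 hbare
  -- composition with the carrier bound
  show VolumeLimitP2 klPredsV14 FinalTwoLegVolLimitEx klWindowC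
  intro G P Q R hG hP hQ hR
  obtain ⟨c₁, hc₁, h₁⟩ := stub_vl_bound G P Q R hG hP hQ hR
  obtain ⟨c₂, hc₂, h₂⟩ := htwo G P Q R hG hP hQ hR
  refine ⟨min c₁ c₂, lt_min hc₁ hc₂, fun c hc hcle => ?_⟩
  obtain ⟨U₁, hU₁, h₁'⟩ := h₁ c hc (hcle.trans (min_le_left _ _))
  obtain ⟨U₂, hU₂, h₂'⟩ := h₂ c hc (hcle.trans (min_le_right _ _))
  refine ⟨min U₁ U₂, lt_min hU₁ hU₂, ?_⟩
  intro μ hμ U hU hUle β hβ hβle K hK Lstar Mstar hT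
  obtain ⟨B, L₁, Mth₁, hB⟩ := h₁' μ hμ U hU (hUle.trans (min_le_left _ _)) β hβ hβle K hK Lstar Mstar hT
  obtain ⟨L₂, Mth₂, D, ρ, hρ, hrate⟩ := h₂' μ hμ U hU (hUle.trans (min_le_right _ _)) β hβ hβle K hK Lstar Mstar hT
  refine exists_finalTwoLegVolLimit_of_twoVolumeRate (L₀ := max L₁ L₂) (Mth := fun L => max (Mth₁ L) (Mth₂ L)) (B := B) (D := D) hρ
    (fun L _ hL M _ hM k σ => hB L (le_of_max_le_left hL) M (le_of_max_le_left hM) k σ) ?_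
  intro L _ hL M _ hM L' _ hLL' M' _ hM' σ ω ω' hωω' k k'
  exact hrate L (le_of_max_le_right hL) M (le_of_max_le_right hM) L' hLL' M' (le_of_max_le_right hM') σ ω ω' hωω' k k'

end Summit.HubbardSuperconductivity.HubbardSuperconductivity.Theorems.KLRegimeVolumeLimit

end
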